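import Summits.AtomisticToContinuum.FouriersLaw.Theorems.EmbeddedDrudeMourreMourreDissolutionFrameworkReflection
import Literature.MathematicalPhysics.KineticTheory.InfiniteChainCurrentMoments

/-!
# Stub F `stub_pencilFramework` of line `gram-pencil-harmonic-chaos`, part F-a: the canonical
symmetric Buttà–Marchioro dynamics of `pinnedChain ω₂ lam β γ` for `lam, β ≥ 0`
(crux `EmbeddedDrudeMourre.DrudeDissolution`, stmt-AtomisticToContinuum-12593; `--supports` file)

The tree's `exists_symmetric_bmDynamics` (file `…MourreDissolutionFrameworkReflection`) builds the
canonical dynamics for `lam, β > 0` only, because it feeds `OscillatorChain.exists_bmDynamics` with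
the degree pattern `(σ₁, σ₂) = (2, 2)`. Buttà–Marchioro's theorem is proved in the tree for ALL
even non-negative polynomials of degrees `2σ₁, 2σ₂ ≥ 2`; the pinning `U = ω₂q²/2 + lam q⁴/4`
(`ω₂ > 0`, `lam ≥ 0`) and the coupling `V = r²/2 + βr⁴/4` (`β ≥ 0`) are such polynomials with
`σ ∈ {1, 2}` according to whether the quartic coefficient vanishes — the HARMONIC endpoint
`lam = β = 0` included. This file records the degree bookkeeping and re-runs the (short) symmetry
argument of `exists_symmetric_bmDynamics` for the general degree pattern:

* `exists_isEvenPolyOfDegree_U_pinnedChain`, `exists_isEvenPolyOfDegree_V_pinnedChain`;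
* `pencilFramework_dynamics` — for `ω₂ > 0`, `lam, β ≥ 0`: ONE dynamics `D` with
  `D.carrier = bmGood`, measurable flow maps, the identity off `bmGood`, the group law on `bmGood`,
  preserving every superstable DLR state at every temperature, commuting EVERYWHERE with the
  translations `τ_x`, with the momentum reversal up to time reversal, and with the spatial
  reflection `ι σ = σ(−·)`.
-/

noncomputable section

namespace Summit.AtomisticToContinuum.FouriersLaw.Theorems.DrudeDissolution.GramPencilHarmonicChaos

open MeasureTheory Filter Set Function Topology
open scoped InnerProductSpace ENNReal
open Literature.MathematicalPhysics.KineticTheory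
open Literature.MathematicalPhysics.KineticTheory.HeatConduction
open Literature.MathematicalPhysics.KineticTheory.PhononBoltzmann

/-- **The pinning of `pinnedChain` is an even non-negative polynomial of degree `2σ₁`,
`σ₁ ∈ {1, 2}`**, for `ω₂ > 0`, `lam ≥ 0` (`σ₁ = 1` at the harmonic endpoint `lam = 0`, where the
leading coefficient is `ω₂/2 > 0`; `σ₁ = 2` for `lam > 0`). [folklore] -/
theorem exists_isEvenPolyOfDegree_U_pinnedChain {ω₂ lam : ℝ} (β γ : ℝ) (hω : 0 < ω₂)
    (hl : 0 ≤ lam) :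
    ∃ s : ℕ, 1 ≤ s ∧ OscillatorChain.IsEvenPolyOfDegree (pinnedChain ω₂ lam β γ).U s := by
  rcases hl.eq_or_lt with h0 | hpos
  · refine ⟨1, le_rfl, fun m => if m = 1 then ω₂ / 2 else 0, ?_, ?_, ?_⟩
    · simp [hω]
    · intro x
      show ω₂ * x ^ 2 / 2 + lam * x ^ 4 / 4 = _
      rw [← h0]
      simp
      ring
    · intro x
      exact OscillatorChain.pinnedChain_U_nonneg β γ hω.le hl x
  · exact ⟨2, by norm_num, OscillatorChain.pinnedChain_isEvenPolyOfDegree_U β γ hω.le hpos⟩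

/-- **The coupling of `pinnedChain` is an even non-negative polynomial of degree `2σ₂`,
`σ₂ ∈ {1, 2}`**, for `β ≥ 0` (`σ₂ = 1` at `β = 0`, leading coefficient `1/2`; `σ₂ = 2` for
`β > 0`). [folklore] -/
theorem exists_isEvenPolyOfDegree_V_pinnedChain (ω₂ lam : ℝ) {β : ℝ} (γ : ℝ) (hβ : 0 ≤ β) :
    ∃ s : ℕ, 1 ≤ s ∧ OscillatorChain.IsEvenPolyOfDegree (pinnedChain ω₂ lam β γ).V s := by
  rcases hβ.eq_or_lt with h0 | hpos
  · refine ⟨1, le_rfl, fun m => if m = 1 then 1 / 2 else 0, ?_, ?_, ?_⟩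
    · simp
    · intro x
      show x ^ 2 / 2 + β * x ^ 4 / 4 = _
      rw [← h0]
      simp
      ring
    · intro x
      show 0 ≤ x ^ 2 / 2 + β * x ^ 4 / 4
      positivity
  · exact ⟨2, by norm_num, OscillatorChain.pinnedChain_isEvenPolyOfDegree_V ω₂ lam γ hpos⟩

/-- **Part F-a of stub F: the canonical symmetric Buttà–Marchioro dynamics of
`pinnedChain ω₂ lam β γ` for `ω₂ > 0`, `lam, β ≥ 0`** (the harmonic endpoint included): ONE
infinite-volume dynamics `D` with carrier `𝒳₀ = bmGood`, measurable flow maps, the identity off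
`𝒳₀`, the group law on `𝒳₀`, preserving every DLR Gibbs state with the superstability estimate at
every temperature, commuting everywhere with the translations `τ_x`, with the momentum reversal
`R` up to time reversal, and with the spatial reflection `ι σ = σ(−·)`. Proof: verbatim
`exists_symmetric_bmDynamics` with the degree pattern `(σ₁, σ₂) ∈ {1,2}²` of
`exists_isEvenPolyOfDegree_U/V_pinnedChain` fed to `OscillatorChain.exists_bmDynamics`.
[cite: ButtaMarchioro2016, §2 Thm 2.1 and eq. (2.6)] -/
theorem pencilFramework_dynamics : ∀ (ω₂ lam β γ : ℝ), 0 < ω₂ → 0 ≤ lam → 0 ≤ β → ∃ D : Literature.MathematicalPhysics.KineticTheory.HeatConduction.InfiniteChainDynamics (Literature.MathematicalPhysics.KineticTheory.HeatConduction.pinnedChain ω₂ lam β γ), D.carrier = (Literature.MathematicalPhysics.KineticTheory.HeatConduction.pinnedChain ω₂ lam β γ).bmGood ∧ (∀ t : ℝ, Measurable (D.flow t)) ∧ (∀ (t : ℝ) (σ : ℤ → ℝ × ℝ), σ ∉ (Literature.MathematicalPhysics.KineticTheory.HeatConduction.pinnedChain ω₂ lam β γ).bmGood → D.flow t σ = σ)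 ∧ (∀ (t s : ℝ) (σ : ℤ → ℝ × ℝ), σ ∈ (Literature.MathematicalPhysics.KineticTheory.HeatConduction.pinnedChain ω₂ lam β γ).bmGood → D.flow (t + s) σ = D.flow t (D.flow s σ)) ∧ (∀ (T : ℝ) (μ : MeasureTheory.Measure (ℤ → ℝ × ℝ)), (Literature.MathematicalPhysics.KineticTheory.HeatConduction.pinnedChain ω₂ lam β γ).IsChainGibbsMeasure T μ → (Literature.MathematicalPhysics.KineticTheory.HeatConduction.pinnedChain ω₂ lam β γ).HasSuperstabilityEstimate μ → D.PreservesMeasure μ) ∧ (∀ (t : ℝ) (x : ℤ), D.flow t ∘ Literature.MathematicalPhysics.KineticTheory.HeatConduction.chainShift x = Literature.MathematicalPhysics.KineticTheory.HeatConduction.chainShift x ∘ D.flow t) ∧ (∀ t : ℝ, Literature.MathematicalPhysics.KineticTheory.HeatConduction.chainReversal ∘ D.flow t = D.flow (-t) ∘ Literature.MathematicalPhysics.KineticTheory.HeatConduction.chainReversal) ∧ (∀ t : ℝ, (fun (σ : ℤ → ℝ × ℝ) (y : ℤ) => σ (-y)) ∘ D.flow t = D.flow t ∘ fun (σ : ℤ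 → ℝ × ℝ) (y : ℤ) => σ (-y)) := by
  -- adapted from `MourreDissolution.exists_symmetric_bmDynamics` (degrees `(2,2)` ↦ `(s₁,s₂)`)
  intro ω₂ lam β γ hω hl hβ
  set P := pinnedChain ω₂ lam β γ with hP
  obtain ⟨s₁, hs₁, hU1⟩ := exists_isEvenPolyOfDegree_U_pinnedChain β γ hω hl
  obtain ⟨s₂, hs₂, hV1⟩ := exists_isEvenPolyOfDegree_V_pinnedChain ω₂ lam γ hβ
  have hU0 : ∀ r, 0 ≤ P.U r := hU1.choose_spec.2.2
  have hV0 : ∀ r, 0 ≤ P.V r := hV1.choose_spec.2.2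
  have hVe : ∀ r, P.V (-r) = P.V r := pinnedChain_V_neg ω₂ lam β γ
  obtain ⟨D, hD, hm, hid, hgrp, -, -, hpres⟩ :=
    OscillatorChain.exists_bmDynamics (P := P) hs₁ hs₂ hU1 hV1
  refine ⟨D, hD, hm, hid, hgrp, hpres, fun t x => ?_, fun t => ?_, fun t => ?_⟩
  · -- translations
    funext σ
    simp only [comp_apply]
    by_cases hσ : σ ∈ P.bmGood
    · exact D.flow_chainShift_of_carrier_eq_bmGood hD hU0 hV0 hσ t x
    · have hσ' : chainShift x σ ∉ P.bmGood := fun h => hσ <| by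
        simpa only [MourreDissolution.chainShift_neg_chainShift] using
          (OscillatorChain.chainShift_mem_bmGood hU0 hV0 h (-x)).1
      rw [hid t σ hσ, hid t _ hσ']
  · -- momentum reversal
    funext σ
    simp only [comp_apply]
    by_cases hσ : σ ∈ P.bmGood
    · have h := D.flow_chainReversal_of_carrier_eq_bmGood hD hσ (-t)
      rw [neg_neg] at h
      exact h.symm
    · have hσ' : chainReversal σ ∉ P.bmGood := fun h => hσ ((P.chainReversal_mem_bmGood_iff σ).1 h)
      rw [hid t σ hσ, hid (-t) _ hσ']
  · -- spatial reflection
    funext σ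
    simp only [comp_apply]
    by_cases hσ : σ ∈ P.bmGood
    · have hcar : MapsTo (fun (σ : ℤ → ℝ × ℝ) (y : ℤ) => σ (-y)) D.carrier D.carrier := by
        rw [hD]; exact MourreDissolution.mapsTo_reflect_bmGood P
      exact (MourreDissolution.flow_reflect D hVe hcar (hD ▸ hσ) t).symm
    · have hσ' : (fun y : ℤ => σ (-y)) ∉ P.bmGood := fun h =>
        hσ ((MourreDissolution.reflect_mem_bmGood_iff P σ).1 h)
      rw [hid t σ hσ, hid t _ hσ']

end Summit.AtomisticToContinuum.FouriersLaw.Theorems.DrudeDissolution.GramPencilHarmonicChaos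

end
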